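import Literature.NumberTheory.EllipticCurves.KatzPAdicLFunctionCMFieldLocalDataRecipeProofs
import HarnessLib

/-!
# Local data of Katz's measure, VI: the fifth cell — `K(√d)/K` is unramified above `2` when
# `d ≡ 1 (mod 4)` (generator `(1 + √d)/2`), so `d_w = 0 = ord_w(a·y + b·x)` at the dyadic unit primes

PROOF-ONLY sequel of files I–V (no definition, no named fact, no `sorry`). Purpose (route
`BiquadraticEisensteinDescent`, crux stmt-BirchSwinnertonDyer-21341, line `hsieh-lambda`, layer 2; memo
`Cruxes/EisensteinHeartFlatCMInertBadKPrime/INSTANTIATION-L-BIQUADRATIC.md` §ADDENDUM 3). The unit cell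
of file V (`hd2_unit`) needs `ℓ ∤ 2d`; at `ℓ = 2` with `d = d_CM` ODD (so `d ≡ 1 (mod 4)`: `d ∈ {−3, −7,
−11, −19, −43, −67, −163}`) and `2 ∣ N_W` (then `2` splits in the Heegner field `K′`, `d_{K′}` odd), the
extension `L = K′(√d)/K′` is still UNRAMIFIED above `2` — by Bombieri–Gubler's Lemma B.2.2
(`NumberFields.isUnramifiedAt_of_isCoprime_of_adjoin_eq_top`) for the generator `θ = (1 + √d)/2` with
`χ = X² − X + (1 − d)/4`, `χ′ = 2X − 1` and the `2`-integral Bezout identity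
`(−4/d)·χ + ((2X − 1)/d)·χ′ = 1` (`d` is a `2`-adic unit):

* `isUnramifiedAt_of_sq_eq_of_one_mod_four` — `L = K(x)`, `x² = d`, `d ≡ 1 (mod 4)`, `w ∣ 2` ⟹ `L/K`
  unramified at `w`;
* `differentExponentAt_eq_zero_of_sq_eq_of_one_mod_four` — `+ 2 ∤ d_K` ⟹ `d_w(L/ℚ) = 0`;
* `hd2_dyadic_unit` — **the fifth cell of the (d2) recipe**: `w ∣ 2`, `d ≡ 1 (mod 4)`, `2 ∤ d_K`, `2 ∤ a`,
  `2 ∣ b` ⟹ `ordAt w (a·y + b·x) = 0 = differentExponentAt w`.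

References: [cite: BombieriGubler2006, Lemma B.2.2]; [cite: NeukirchANT1999, Ch. III §2];
[cite: Hsieh2014mu, §3.1 (d2)].
-/

set_option autoImplicit false

noncomputable section

open scoped nonZeroDivisors NumberField

namespace Literature.NumberTheory.EllipticCurves

open NumberField IsDedekindDomain Polynomial Literature.NumberTheory.NumberFields

variable {K : Type} [Field K] [NumberField K] (L : Type) [Field L] [NumberField L] [Algebra K L]

/-- **`L = K(x)`, `x² = d` with `d ≡ 1 (mod 4)`, `w ∣ 2` ⟹ `L/K` is unramified at `w`** (Bombieri–Gubler B.2.2 with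
`θ = (1 + x)/2`, `χ = X² − X + (1 − d)/4`, `a = −4/d`, `b = (2X − 1)/d`). [cite: BombieriGubler2006, Lemma B.2.2] -/
theorem isUnramifiedAt_of_sq_eq_of_one_mod_four {x : L} {d : ℤ} (hgen : Algebra.adjoin K {x} = ⊤)
    (hx : x ^ 2 = (d : L)) (hd4 : d % 4 = 1) (w : HeightOneSpectrum (𝓞 L))
    (hw : ((2 : ℕ) : 𝓞 L) ∈ w.asIdeal) : Algebra.IsUnramifiedAt (𝓞 K) w.asIdeal := by
  -- the prime `v = w ∩ 𝓞 K` of `K` below `w`; `2 ∈ v`, `d ∉ v`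
  have hne : w.asIdeal.under (𝓞 K) ≠ ⊥ := mt Ideal.eq_bot_of_comap_eq_bot w.ne_bot
  let v : HeightOneSpectrum (𝓞 K) := ⟨w.asIdeal.under (𝓞 K), Ideal.IsPrime.under _ _, hne⟩
  have hv2 : ((2 : ℕ) : 𝓞 K) ∈ v.asIdeal := by
    change _ ∈ w.asIdeal.under (𝓞 K); rw [Ideal.mem_comap, map_natCast]; exact hw
  have hdodd : ¬ (2 : ℤ) ∣ d := by omega
  have hdv : ((d : ℤ) : 𝓞 K) ∉ v.asIdeal :=
    intCast_not_mem_of_not_dvd Nat.prime_two v hv2 hdodd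
  have hd0 : (d : K) ≠ 0 := by
    have : (d : ℤ) ≠ 0 := by rintro rfl; exact hdodd (dvd_zero _)
    exact_mod_cast this
  -- valuations at `v`: `v(d) = 1`, `v(d⁻¹) = 1`, `v(2), v(4) ≤ 1`
  have hvd : v.valuation K (d : K) = 1 := by
    have := valuation_eq_one_of_not_mem v hdv
    simpa using this
  have hvdi : v.valuation K (d : K)⁻¹ = 1 := by rw [map_inv₀, hvd, inv_one]
  have hint : ∀ n : ℤ, v.valuation K (n : K) ≤ 1 := fun n ↦ by
    have := v.valuation_le_one (K := K) ((n : ℤ) : 𝓞 K)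
    simpa using this
  -- the generator `θ = (1 + x)/2`
  set θ : L := (1 + x) / 2 with hθ
  have hxθ : x = θ + θ - 1 := by rw [hθ]; ring
  have hgenθ : Algebra.adjoin K {θ} = ⊤ := by
    refine top_le_iff.mp (hgen ▸ Algebra.adjoin_le ?_)
    rintro _ rfl
    rw [hxθ]
    exact Subalgebra.sub_mem _ (Subalgebra.add_mem _ (Algebra.self_mem_adjoin_singleton K θ)
      (Algebra.self_mem_adjoin_singleton K θ)) (Subalgebra.one_mem _)
  -- `c = (1 - d)/4 ∈ ℤ`
  obtain ⟨c, hc⟩ : ∃ c : ℤ, 1 - d = 4 * c := ⟨(1 - d) / 4, by omega⟩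
  set χ : K[X] := X ^ 2 - X + C (c : K) with hχdef
  have hχ : χ.Monic := by
    rw [hχdef]
    refine Monic.add_of_left (Monic.sub_of_left (monic_X_pow 2) (by rw [degree_X_pow, degree_X]; norm_num)) ?_
    rw [degree_sub_eq_left_of_degree_lt (by rw [degree_X_pow, degree_X]; norm_num), degree_X_pow]
    exact (degree_C_le).trans_lt (by norm_num)
  have hroot : aeval θ χ = 0 := by
    rw [hχdef]
    simp only [map_add, map_sub, aeval_X_pow, aeval_X, aeval_C]
    have h4c : (4 : L) * (c : L) = 1 - (d : L) := by exact_mod_cast (show (4 * c : ℤ) = 1 - d by omega)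
    rw [hθ, show algebraMap K L (c : K) = (c : L) by simp]
    have hc' : (c : L) = (1 - (d : L)) / 4 := by rw [← h4c]; ring
    have : ((1 + x) / 2) ^ 2 - (1 + x) / 2 + (c : L) = (x ^ 2 - (d : L)) / 4 := by
      rw [hc']; ring
    rw [this, hx, sub_self, zero_div]
  have hderiv : derivative χ = C (2 : K) * X - 1 := by
    rw [hχdef, derivative_add, derivative_sub, derivative_X_pow, derivative_X, derivative_C]
    simp
  -- Bezout: `(−4/d)·χ + ((2X − 1)/d)·χ′ = 1`
  have hab : (-C ((4 : K) * (d : K)⁻¹)) * χ + (C (d : K)⁻¹ * (C (2 : K) * X - 1)) * derivative χ = 1 := by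
    rw [hderiv, hχdef]
    have hcd : (1 : K) - 4 * (c : K) = (d : K) := by exact_mod_cast (show (1 - 4 * c : ℤ) = d by omega)
    -- polynomial identity: both sides are constants; compare via `C`
    have : (-C ((4 : K) * (d : K)⁻¹)) * (X ^ 2 - X + C (c : K)) + (C (d : K)⁻¹ * (C (2 : K) * X - 1)) * (C (2 : K) * X - 1)
        = C ((d : K)⁻¹ * (1 - 4 * (c : K))) := by
      simp only [map_mul, map_sub, map_one, map_ofNat]
      ring
    rw [this, hcd, inv_mul_cancel₀ hd0, C_1]
  -- integrality of the coefficients at `v`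
  set R := Polynomial.liftsRing (v.valuation K).valuationSubring.subtype with hR
  have hX : (X : K[X]) ∈ R := X_mem_liftsRing v
  have hCc : C (c : K) ∈ R := C_mem_liftsRing_of_valuation_le_one v (hint c)
  have hC2 : C (2 : K) ∈ R := by simpa using C_mem_liftsRing_of_valuation_le_one v (hint 2)
  have hCdi : C (d : K)⁻¹ ∈ R := C_mem_liftsRing_of_valuation_le_one v hvdi.le
  have hC4d : C ((4 : K) * (d : K)⁻¹) ∈ R := C_mem_liftsRing_of_valuation_le_one v (by
    rw [map_mul, hvdi, mul_one]; simpa using hint 4)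
  haveI : w.asIdeal.IsMaximal := w.isMaximal
  exact isUnramifiedAt_of_isCoprime_of_adjoin_eq_top v hgenθ hχ hroot hab
    (valuation_coeff_le_one_of_mem_liftsRing v (R.add_mem (R.sub_mem (R.pow_mem hX 2) hX) hCc))
    (valuation_coeff_le_one_of_mem_liftsRing v (R.neg_mem hC4d))
    (valuation_coeff_le_one_of_mem_liftsRing v (R.mul_mem hCdi (R.sub_mem (R.mul_mem hC2 hX) R.one_mem)))
    w.asIdeal rfl

/-- **`L = K(x)`, `x² = d ≡ 1 (mod 4)`, `2 ∤ d_K`, `w ∣ 2` ⟹ `d_w(L/ℚ) = 0`.** [cite: NeukirchANT1999, Ch. III §2]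
[cite: BombieriGubler2006, Lemma B.2.2] -/
theorem differentExponentAt_eq_zero_of_sq_eq_of_one_mod_four {x : L} {d : ℤ} (hgen : Algebra.adjoin K {x} = ⊤)
    (hx : x ^ 2 = (d : L)) (hd4 : d % 4 = 1) (w : HeightOneSpectrum (𝓞 L))
    (hw : ((2 : ℕ) : 𝓞 L) ∈ w.asIdeal) (hdK : ¬ (2 : ℤ) ∣ NumberField.discr K) :
    differentExponentAt w = 0 := by
  have hne : w.asIdeal.under (𝓞 K) ≠ ⊥ := mt Ideal.eq_bot_of_comap_eq_bot w.ne_bot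
  let v : HeightOneSpectrum (𝓞 K) := ⟨w.asIdeal.under (𝓞 K), Ideal.IsPrime.under _ _, hne⟩
  have hv2 : ((2 : ℕ) : 𝓞 K) ∈ v.asIdeal := by
    change _ ∈ w.asIdeal.under (𝓞 K); rw [Ideal.mem_comap, map_natCast]; exact hw
  rw [differentExponentAt_eq_of_isUnramifiedAt L w v rfl (isUnramifiedAt_of_sq_eq_of_one_mod_four L hgen hx hd4 w hw)]
  exact differentExponentAt_eq_zero_of_not_dvd_discr Nat.prime_two v hv2 (by exact_mod_cast hdK)

/-- **(d2), DYADIC UNIT CELL: `w ∣ 2`, `d ≡ 1 (mod 4)`, `2 ∤ d_K`, `2 ∤ a`, `2 ∣ b` ⟹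
`ord_w(a·y + b·x) = 0 = d_w`** (`y² = d_K`). [cite: Hsieh2014mu, §3.1 (d2)] -/
theorem hd2_dyadic_unit {x : L} {d : ℤ} (hgen : Algebra.adjoin K {x} = ⊤) (hx : x ^ 2 = (d : L))
    (hd4 : d % 4 = 1) {y : K} (hy : y ^ 2 = (NumberField.discr K : K)) (w : HeightOneSpectrum (𝓞 L))
    (hw : ((2 : ℕ) : 𝓞 L) ∈ w.asIdeal) (hdK : ¬ (2 : ℤ) ∣ NumberField.discr K)
    {a b : ℤ} (ha : ¬ (2 : ℤ) ∣ a) (hb : (2 : ℤ) ∣ b) :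
    ordAt w ((a : L) * algebraMap K L y + (b : L) * x) = differentExponentAt w := by
  have hY := sq_algebraMap_eq_discr L hy
  have hdK0 : NumberField.discr K ≠ 0 := NumberField.discr_ne_zero K
  have hy0 : algebraMap K L y ≠ 0 := by
    intro h; rw [h, zero_pow two_ne_zero, eq_comm, Int.cast_eq_zero] at hY; exact hdK0 hY
  rw [differentExponentAt_eq_zero_of_sq_eq_of_one_mod_four L hgen hx hd4 w hw hdK]
  exact ordAt_lin_eq_zero Nat.prime_two w hw hy0
    (ordAt_eq_zero_of_sq_eq_intCast Nat.prime_two w hw hY (by exact_mod_cast hdK))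
    (ordAt_nonneg_of_sq_eq_intCast w hx) (by exact_mod_cast ha) (by exact_mod_cast hb)

end Literature.NumberTheory.EllipticCurves

end
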